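import Literature.MathematicalPhysics.QuantumFieldTheory.Balaban1983to89.B15Prop1RealChartFamilyFromMinimiserChart
import Literature.MathematicalPhysics.QuantumFieldTheory.Balaban1983to89.B14Eq12InteriorLocality
import Mathlib.Analysis.Calculus.InverseFunctionTheorem.FDeriv

/-!
# `Balaban1983to89.B15Prop1RealChartFamilySupport` — [Balaban1988Convergent] = «[III]», (2.2) p. 255 («Γ₀ = Ω₁ᶜ»), (2.11)–(2.12) p. 256 («M_𝐁(U) = M^j(U) on Γ_j,
# j = 0, 1, …, k», `M⁰ = id`), (1.3) p. 246 ∕ (2.16) p. 257 (the pull-back `Q_k^{s*}`); [Balaban1989LargeFieldI] = «[IV]», (1.74) p. 192, Prop. 1 p. 194 (last clause);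
# [Balaban1989LargeFieldII] = «[LF-II]», p. 357 and p. 359 («Fixing the gauge G₀ for V′ … V′ = exp iB′»); [Balaban1985Variational] = «[15]», (15) p. 280, Prop. 9 (190) p. 309:
# ★★ THE SUPPORT LETTER OF THE REAL CHART FAMILY (K′) — ALONG ANY FAMILY OF (2.12) MINIMISERS IN THE EXPONENTIAL CHART AT `U₀` THE CHART COORDINATES, HENCE THE
# VELOCITY `X_f′(0)X`, VANISH ON EVERY `Γ₀`-BOND WHOSE COARSE SHADOW IS NOT A FREE BOND OF THE SLICE

Honest framing: statement-level skeleton of published theorems with citation tags; proofs where landed; nothing here is a claim about the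
Yang–Mills mass gap.  Cell `pub-ymgap`, HUMAN RULING D-0154 (R399 (3a) width seats), seat `pub-ymgap-dag-n12-w5` (g3; N12 = [B15], own lineage (K′) =
`B15Prop1RealChartFamilyFromMinimiserChart`, p608072); count-neutral helper of K1⁷ (`stmt-QuantumFields-20542`); N12 NOT discharged; finite 𝕋⁴ at fixed ε;
nothing continuum ∕ OS ∕ mass-gap ∕ Clay.

WHY.  The assembled endpoint of the N12∕s1 lane (`B15Prop1EndpointNearFlatLetters`, p610003∕p612688) reads, per instance and base field, the near-flat letter
package (N) — among its conjuncts the bond-wise `A₀`-gauge letter `hU : ∀ b, ‖U₀ b − 1‖ ≤ δc i` for THE SAME `U₀` at which the (K′) family `expChart U₀ (X_f Y)` of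
(2.12) minimisers sits (`hmin`).  By [III] (2.2) the scale-`0` member of the determining set `𝐁_k(Z) = Bj M₁ Z k` is `Γ₀ = Ω₁(Z)ᶜ` (`B14.Eq213DetSet.Bj_zero`), and by
(2.11)–(2.12) with `M⁰ = id` a constrained configuration IS the datum on every `Γ₀`-bond (`B14Eq12InteriorLocality.extBonds`: «the (2.12) constraint at scale 0
FIXES a constrained configuration to the datum»).  Two consequences for the lane: (a) `U₀` is PINNED on the `Γ₀`-bonds to the pulled-back base field
`Q_k^{s*}(ext Ṽ_k)` ((1.3)∕(2.16): `1` inside `k`-blocks, the raw coarse bond variable on corridor bonds — `B14Eq216Concrete.qsstarGIter0_eq`), so a bond-wise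
nearness to `1` on ALL bonds of `T_η` is not available there by any choice; (b) — THIS MODULE — the whole family is pinned on those `Γ₀`-bonds whose coarse shadow
`⟨blockIter k b₋, μ(b)⟩` is not a free bond of the slice (there the perturbed datum `Q_k^{s*}(exp(i·ιA Y)·ext Ṽ_k)` does not move with `Y`), hence
`U₀(b)·exp(X_f Y (b)) = U₀(b)`, `exp(X_f Y (b)) = 1`, and — `exp` being injective near `0` on `𝔰𝔲(N)` and `X_f` continuous at `0` with `X_f 0 = 0` — `X_f Y (b) = 0`
for all `Y` near `0`, so the velocity `X_f′(0)X` VANISHES on those bonds.  With the endpoint's `hfar` clause (`b₋ ∉ Ω₁(Z) ⇒` the shadow misses the bonds of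
`Λ^{(k)}`) this is every bond with `b₋ ∉ Ω₁(Z)`.  This is the shape a LOCALISED second-variation letter (δ₁) consumes: the comparison of the Hessians of the Wilson
action at `U₀` and at `1` in the direction `w = X_f′(0)X` involves `U₀` only on the bonds of plaquettes carrying a bond where `w ≠ 0`.

CONTENTS (theorems only; no `def`, no `instance`, no `sorry`).
* §1 `eventually_eq_zero_of_expSU_eq_one` (local injectivity of `exp : 𝔰𝔲(N) → SU(N)` at `0`, from Mathlib's inverse function theorem at `hasStrictFDerivAt_exp_zero`),
  `eventually_forall_apply_eq_zero_of_expChart_apply_eq` (bond-field form: near `0`, `expChart U X b = U b ⇒ X b = 0` for every bond).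
* §2 `apply_eq_of_isMinimizer_of_mem_extBonds` (ANY group ∕ averaging ∕ class: a (2.12) minimiser equals the scale-`0` datum on the `Γ₀`-bonds),
  `apply_eq_of_isMinimizer_Bj_of_not_mem` (at `𝐁_k(Z)`: on every bond meeting `Ω₁(Z)ᶜ`).
* §3 `expMul_ιA_apply_of_not_mem_freeBonds`, `qsstarGIter0_expMul_ιA_of_not_mem_freeBonds` (the pulled-back slice datum is `Y`-independent on a fine bond whose
  coarse shadow is not a free bond).
* §4 ★★ `eventually_apply_eq_zero_of_isMinimizer_expChart_family` (generic determining set: the chart coordinates of the family vanish, near `Y = 0`, on every `Γ₀`-bond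
  with shadow off the free bonds), (private) `fderiv_apply_eq_zero_of_eventually_apply_eq_zero` (bookkeeping), ★★ `fderiv_apply_eq_zero_of_isMinimizer_expChart_family` (so does
  the velocity `fderiv ℝ X_f 0 X`, with NO differentiability hypothesis).
* §5 ★★★ `support_realChartFamily_atRecord` — AT THE ENDPOINT'S OBJECTS VERBATIM (`Node00.avOfRecord F 2 Kt`, `Node00.regMSCoPOfRecord F 2 ν Kt k (maxDomT ν.M₁ Z)`,
  `Bj ν.M₁ Z k`, datum `M˙(Q_k^{s*}(exp(i·ιA Y)·ext Ṽ_k))`, `0 < k ≤ m + K`, the endpoint's `hfar` clause at one instance): from (K′)'s conclusions `X_f 0 = 0`, `X_f`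
  continuous at `0`, `hmin` ⊢ `(∀ᶠ Y, ∀ b, b₋ ∉ Ω₁(Z) → X_f Y b = 0) ∧ ∀ X b, b₋ ∉ Ω₁(Z) → (fderiv ℝ X_f 0 X) b = 0`.
HONEST SCOPE: finite-dimensional calculus and the tree's (2.2)∕(2.11)∕(2.16) bookkeeping; the family (K′) and its minimality letter are HYPOTHESES (producers: this lineage's
p608072 from the w1 lineage's (J0′)); nothing of Bałaban's estimates is asserted; N12 NOT discharged; K1⁷ NOT closed.
-/

noncomputable section

open Set Metric Filter
open scoped Topology Matrix.Norms.L2Operator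

namespace Literature.MathematicalPhysics.QuantumFieldTheory.Balaban1983to89.B15Prop1RealChartFamilySupport

open B15Prop1SliceCoordinates (GaugeSlice ιA freeBonds mem_freeBonds ιA_apply_of_not_mem)
open B15Prop1ChartCalculusSU2 (E3)
open B15Prop1ChartSU2 (su2Chart)
open T4CubeChartGnomonic (SU2)
open T4Continuum B15DeterminingSets GaugeField
open T4AdjointCovarianceUnitary (lieSU expSU coe_expSU)
open Node00 (expChart expChart_zero SU)
open B14.Eq213DetSet B14.Eq216Concrete B14.Eq22Determines
open B16Sect1Backgrounds (expMul ExpChart)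
open B14.Eq12InteriorLocality (extBonds)
open Literature.MathematicalPhysics.QuantumFieldTheory.BalabanImbrieJaffe1984to88.BIJ85Eq453GaugeField (qsstarGIter0)

/-! ## §1  `exp` is injective near `0` on `𝔰𝔲(N)`; bond-field form -/

section ExpInjective

variable {N : ℕ}

/-- **`exp : 𝔰𝔲(N) → SU(N)` IS INJECTIVE NEAR `0`** (in the form the support letter uses): for all `X` near `0`, `exp X = 1 ⇒ X = 0` — the matrix exponential has the
invertible strict derivative `1` at `0` (Mathlib `hasStrictFDerivAt_exp_zero`), hence a local left inverse (`HasStrictFDerivAt.eventually_left_inverse`), pulled back along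
the continuous inclusion `𝔰𝔲(N) ⊂ M_N(ℂ)`. [cite: Balaban1985RegularSpaces, (1.10) p.77 (bookkeeping: first order of `exp`); Balaban1989LargeFieldII, (1.19) p.360 («(1/i) log»)] -/
theorem eventually_eq_zero_of_expSU_eq_one : ∀ᶠ X in 𝓝 (0 : lieSU (Fin N)), expSU X = 1 → X = 0 := by
  have hexp : HasStrictFDerivAt (NormedSpace.exp : Matrix (Fin N) (Fin N) ℂ → Matrix (Fin N) (Fin N) ℂ)
      ((ContinuousLinearEquiv.refl ℂ (Matrix (Fin N) (Fin N) ℂ) : Matrix (Fin N) (Fin N) ℂ →L[ℂ] Matrix (Fin N) (Fin N) ℂ)) 0 :=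
    hasStrictFDerivAt_exp_zero (𝕂 := ℂ) (𝔸 := Matrix (Fin N) (Fin N) ℂ)
  have hleft := hexp.eventually_left_inverse
  have hcont : Continuous fun X : lieSU (Fin N) => (X : Matrix (Fin N) (Fin N) ℂ) := continuous_subtype_val
  have htend : Tendsto (fun X : lieSU (Fin N) => (X : Matrix (Fin N) (Fin N) ℂ)) (𝓝 0) (𝓝 0) := by
    have h := hcont.continuousAt (x := (0 : lieSU (Fin N)))
    rw [ContinuousAt, Submodule.coe_zero] at h
    exact h
  filter_upwards [htend.eventually hleft] with X hX hX1
  have h1 : NormedSpace.exp (X : Matrix (Fin N) (Fin N) ℂ) = NormedSpace.exp (0 : Matrix (Fin N) (Fin N) ℂ) := by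
    rw [← coe_expSU, hX1, NormedSpace.exp_zero]
    rfl
  have h2 : (X : Matrix (Fin N) (Fin N) ℂ) = 0 := by
    rw [← hX, h1]
    exact hexp.localInverse_apply_image
  exact (Submodule.coe_eq_zero).1 h2

/-- **BOND-FIELD FORM**: for a Lie-algebra bond field `X` near `0` (product topology), at every bond `b` with `expChart U X b = U b` (i.e. `U_b·exp(X_b) = U_b`) one has
`X b = 0` — finitely many bonds, each coordinate map continuous. [cite: Balaban1985Variational, (15) p.280 («U = U′U₀», bookkeeping); Balaban1985RegularSpaces, (1.10) p.77] -/
theorem eventually_forall_apply_eq_zero_of_expChart_apply_eq {P : Params} {j : ℕ} (U : GaugeField P j (SU N)) :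
    ∀ᶠ X in 𝓝 (0 : PBond P j → lieSU (Fin N)), ∀ b : PBond P j, expChart U X b = U b → X b = 0 := by
  have hb : ∀ b : PBond P j, ∀ᶠ X in 𝓝 (0 : PBond P j → lieSU (Fin N)), expChart U X b = U b → X b = 0 := by
    intro b
    have ht : Tendsto (fun X : PBond P j → lieSU (Fin N) => X b) (𝓝 0) (𝓝 0) :=
      (continuous_apply b).continuousAt
    filter_upwards [ht.eventually eventually_eq_zero_of_expSU_eq_one] with X hX hUX
    apply hX
    have h : U b * expSU (X b) = U b * 1 := by rw [mul_one]; exact hUX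
    exact mul_left_cancel h
  exact eventually_all.2 hb

end ExpInjective

/-! ## §2  The `Γ₀`-pin of a (2.12) minimiser -/

section Pin

variable {P : Params} {G : Type*} [GaugeGroup G]

/-- **THE `Γ₀`-PIN**: a (2.12) minimal configuration `U` for the datum `V` on the determining set `𝔹` EQUALS the scale-`0` datum `V₀` on every `Γ₀`-bond
(`extBonds 𝔹 = bondsOf (𝔹 0)`) — the constraint `M_𝔹(U) = V` at `j = 0` with `M⁰ = id` ((2.11): «M_𝐁(U) = M^j(U) on Γ_j, j = 0, 1, …, k»).  Any group, any averaging,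
any class. [cite: Balaban1988Convergent, (2.2) p.255, (2.11)–(2.12) p.256] -/
theorem apply_eq_of_isMinimizer_of_mem_extBonds (av : ∀ j, Averaging P j G) (reg : Set (GaugeField P 0 G)) (𝔹 : DetSet P)
    (V : MSField P G) {U : GaugeField P 0 G} (hU : IsMinimizer av reg 𝔹 V U) {b : PBond P 0} (hb : b ∈ extBonds 𝔹) : U b = V 0 b :=
  hU.2.1 0 b hb

/-- At `𝐁_k(Z)` (`k ≥ 1`): a (2.12) minimiser equals the scale-`0` datum on every bond MEETING `Ω₁(Z)ᶜ` — `Γ₀ = Ω₁ᶜ` ([III] (2.2), `B14.Eq213DetSet.Bj_zero`).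
[cite: Balaban1988Convergent, (2.2) p.255, (2.12)–(2.13) pp.256–257] -/
theorem apply_eq_of_isMinimizer_Bj_of_not_mem (av : ∀ j, Averaging P j G) (reg : Set (GaugeField P 0 G)) (M₁ : ℕ) (Z : Set (Site P 0))
    {k : ℕ} (hk0 : 0 < k) (V : MSField P G) {U : GaugeField P 0 G} (hU : IsMinimizer av reg (Bj M₁ Z k) V U) {b : PBond P 0}
    (hb : b.src ∉ maxDomT M₁ Z 1 ∨ b.tgt ∉ maxDomT M₁ Z 1) : U b = V 0 b := by
  refine apply_eq_of_isMinimizer_of_mem_extBonds av reg (Bj M₁ Z k) V hU ?_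
  show b ∈ bondsOf (Bj M₁ Z k 0)
  rw [Bj_zero hk0]
  exact hb

end Pin

/-! ## §3  The pulled-back slice datum is `Y`-independent off the slice's coarse shadow -/

section Datum

variable {P : Params} {k : ℕ} [DecidableEq (PBond P k)] {G : Type*} [GaugeGroup G]
  {𝔤 : Type*} [NormedAddCommGroup 𝔤] [InnerProductSpace ℝ 𝔤] (ch : ExpChart G 𝔤)

/-- On a coarse bond that is not a free bond of the slice the perturbed base field is the base field: `(exp(i·ιA Y)·W)(c) = W(c)` (`ιA Y (c) = 0` there, `iexp 0 = 1`).
[cite: Balaban1989LargeFieldII, p.359 («B′ satisfying the gauge condition B′↾_{G₀} = 0»)] -/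
theorem expMul_ιA_apply_of_not_mem_freeBonds (S : Set (Site P k)) (T : Finset (PBond P k)) (Y : GaugeSlice S T 𝔤) (W : GaugeField P k G)
    {c : PBond P k} (hc : c ∉ freeBonds S T) : expMul ch (ιA S T Y) W c = W c := by
  show ch.iexp (ιA S T Y c) * W c = W c
  rw [ιA_apply_of_not_mem Y hc, ch.iexp_zero, one_mul]

/-- **THE PULLED-BACK SLICE DATUM DOES NOT MOVE OFF THE SHADOW**: for a fine bond `b` whose coarse shadow `⟨blockIter k b₋, μ(b)⟩` is not a free bond of the slice,
`(Q_k^{s*}(exp(i·ιA Y)·W))(b) = (Q_k^{s*}W)(b)` for every `Y` ((1.3)∕(2.16): the pull-back reads `W` only at the shadow — `B14Eq216Concrete.qsstarGIter0_eq`; standing range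
`k ≤ m + K`). [cite: Balaban1988Convergent, (1.3) p.246, (2.16) p.257; Balaban1989LargeFieldII, p.359] -/
theorem qsstarGIter0_expMul_ιA_of_not_mem_freeBonds (hk : k ≤ P.m + P.K) (S : Set (Site P k)) (T : Finset (PBond P k)) (Y : GaugeSlice S T 𝔤)
    (W : GaugeField P k G) {b : PBond P 0} (hb : (⟨blockIter k b.src, b.dir⟩ : PBond P k) ∉ freeBonds S T) :
    qsstarGIter0 k (expMul ch (ιA S T Y) W) b = qsstarGIter0 k W b := by
  rw [qsstarGIter0_eq k hk, qsstarGIter0_eq k hk]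
  by_cases h : blockIter k b.tgt = blockIter k b.src
  · rw [if_pos h, if_pos h]
  · rw [if_neg h, if_neg h, expMul_ιA_apply_of_not_mem_freeBonds ch S T Y W hb]

end Datum

/-! ## §4  The support letter along any family of (2.12) minimisers in the exponential chart -/

section Support

variable {P : Params} {k : ℕ} [DecidableEq (PBond P k)] {N : ℕ} [NeZero N]
  {𝔤 : Type*} [NormedAddCommGroup 𝔤] [InnerProductSpace ℝ 𝔤] (ch : ExpChart (SU N) 𝔤)

/-- ★★ **THE CHART COORDINATES OF A FAMILY OF (2.12) MINIMISERS VANISH ON THE PINNED BONDS.**  Let `Y ↦ expChart U₀ (X_f Y)` be, for `Y` near `0` in the slice, a (2.12)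
minimal configuration for the datum `M˙(Q_k^{s*}(exp(i·ιA (Yv Y))·W))` on a determining set `𝔹` (any averaging family `av`, any class `reg`, any parameter space `G'`
mapped into the slice by `Yv`), with `X_f 0 = 0` and `X_f` continuous at `0`.  Then for all `Y` near `0`: on every `Γ₀`-bond `b ∈ extBonds 𝔹` whose coarse shadow `⟨blockIter k b₋, μ(b)⟩` is not a free bond of the slice, `X_f Y (b) = 0` —
the configuration is pinned there to a `Y`-independent datum (§2, §3), so `U₀(b)·exp(X_f Y (b)) = U₀(b)`, and `exp` is injective near `0` (§1).
[cite: Balaban1988Convergent, (2.2) p.255, (2.11)–(2.12) p.256, (2.16) p.257; Balaban1985Variational, (15) p.280, Prop. 9 (190) p.309; Balaban1989LargeFieldII, p.359] -/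
theorem eventually_apply_eq_zero_of_isMinimizer_expChart_family (hk : k ≤ P.m + P.K) (S : Set (Site P k)) (T : Finset (PBond P k))
    (av : ∀ j, Averaging P j (SU N)) (reg : Set (GaugeField P 0 (SU N))) (𝔹 : DetSet P) (W : GaugeField P k (SU N))
    (U₀ : GaugeField P 0 (SU N)) {G' : Type*} [TopologicalSpace G'] [Zero G'] (Yv : G' → GaugeSlice S T 𝔤)
    (Xf : G' → PBond P 0 → lieSU (Fin N)) (hX₀ : Xf 0 = 0) (hXc : ContinuousAt Xf 0)
    (hmin : ∀ᶠ Y in 𝓝 (0 : G'), IsMinimizer av reg 𝔹 (avgFamily av (qsstarGIter0 k (expMul ch (ιA S T (Yv Y)) W))) (expChart U₀ (Xf Y))) :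
    ∀ᶠ Y in 𝓝 (0 : G'), ∀ b : PBond P 0, b ∈ extBonds 𝔹 → (⟨blockIter k b.src, b.dir⟩ : PBond P k) ∉ freeBonds S T → Xf Y b = 0 := by
  -- the base point: `U₀` itself is pinned to `Q_k^{s*}W` on the `Γ₀`-bonds
  have hmin0 : IsMinimizer av reg 𝔹 (avgFamily av (qsstarGIter0 k (expMul ch (ιA S T (Yv 0)) W))) (expChart U₀ (Xf 0)) := hmin.self_of_nhds
  rw [hX₀, expChart_zero] at hmin0
  -- `X_f Y → 0`, so §1 applies along the family
  have htend : Tendsto Xf (𝓝 0) (𝓝 0) := by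
    have h := hXc
    rw [ContinuousAt, hX₀] at h
    exact h
  filter_upwards [hmin, htend.eventually (eventually_forall_apply_eq_zero_of_expChart_apply_eq U₀)] with Y hY hinj b hb hsh
  apply hinj b
  -- both configurations equal the (common) datum at `b`
  have h1 : expChart U₀ (Xf Y) b = qsstarGIter0 k (expMul ch (ιA S T (Yv Y)) W) b :=
    apply_eq_of_isMinimizer_of_mem_extBonds av reg 𝔹 _ hY hb
  have h0 : U₀ b = qsstarGIter0 k (expMul ch (ιA S T (Yv 0)) W) b :=
    apply_eq_of_isMinimizer_of_mem_extBonds av reg 𝔹 _ hmin0 hb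
  rw [h1, h0, qsstarGIter0_expMul_ιA_of_not_mem_freeBonds ch hk S T (Yv Y) W hsh,
    qsstarGIter0_expMul_ιA_of_not_mem_freeBonds ch hk S T (Yv 0) W hsh]

/-- **BOOKKEEPING: a coordinate that vanishes near `0` has vanishing velocity** — for any map `X_f` into bond fields with `X_f Y (b) = 0` for `Y` near `0`, the `b`-component of
`fderiv ℝ X_f 0 X` is `0` for every direction `X` (if `X_f` is differentiable at `0` by the chain rule through the evaluation map, otherwise `fderiv = 0`); private plumbing. [folklore] -/
private theorem fderiv_apply_eq_zero_of_eventually_apply_eq_zero {G' : Type*} [NormedAddCommGroup G'] [NormedSpace ℝ G']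
    {ι E : Type*} [Fintype ι] [NormedAddCommGroup E] [NormedSpace ℝ E]
    (Xf : G' → ι → E) {b : ι} (h : ∀ᶠ Y in 𝓝 (0 : G'), Xf Y b = 0) (X : G') : fderiv ℝ Xf 0 X b = 0 := by
  by_cases hd : DifferentiableAt ℝ Xf 0
  · have hcomp : fderiv ℝ (fun Y => Xf Y b) 0 = (ContinuousLinearMap.proj (R := ℝ) b).comp (fderiv ℝ Xf 0) := by
      have h1 : HasFDerivAt (fun Y => Xf Y b) ((ContinuousLinearMap.proj (R := ℝ) b).comp (fderiv ℝ Xf 0)) 0 :=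
        (ContinuousLinearMap.proj (R := ℝ) (φ := fun _ : ι => E) b).hasFDerivAt.comp 0 hd.hasFDerivAt
      exact h1.fderiv
    have hzero : fderiv ℝ (fun Y => Xf Y b) 0 = 0 := by
      have hc : (fun Y => Xf Y b) =ᶠ[𝓝 0] fun _ => (0 : E) := h
      rw [hc.fderiv_eq, fderiv_const_apply]
    have h2 := congrArg (fun L : G' →L[ℝ] E => L X) (hcomp.symm.trans hzero)
    simpa using h2
  · rw [fderiv_zero_of_not_differentiableAt hd]
    rfl

/-- ★★ **THE VELOCITY OF THE FAMILY VANISHES ON THE PINNED BONDS**: under the hypotheses of `eventually_apply_eq_zero_of_isMinimizer_expChart_family` (family indexed by the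
slice itself), for every slice vector `X` and every `Γ₀`-bond `b ∈ extBonds 𝔹` with shadow off the free bonds, `(fderiv ℝ X_f 0 X) b = 0` — no differentiability hypothesis.
[cite: Balaban1988Convergent, (2.2) p.255, (2.11)–(2.12) p.256, (2.16) p.257; Balaban1985Variational, Prop. 9 (190) p.309; Balaban1989LargeFieldII, (1.12) p.359] -/
theorem fderiv_apply_eq_zero_of_isMinimizer_expChart_family (hk : k ≤ P.m + P.K) (S : Set (Site P k)) (T : Finset (PBond P k))
    (av : ∀ j, Averaging P j (SU N)) (reg : Set (GaugeField P 0 (SU N))) (𝔹 : DetSet P) (W : GaugeField P k (SU N))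
    (U₀ : GaugeField P 0 (SU N)) (Xf : GaugeSlice S T 𝔤 → PBond P 0 → lieSU (Fin N)) (hX₀ : Xf 0 = 0) (hXc : ContinuousAt Xf 0)
    (hmin : ∀ᶠ Y in 𝓝 (0 : GaugeSlice S T 𝔤), IsMinimizer av reg 𝔹 (avgFamily av (qsstarGIter0 k (expMul ch (ιA S T Y) W))) (expChart U₀ (Xf Y)))
    (X : GaugeSlice S T 𝔤) {b : PBond P 0} (hb : b ∈ extBonds 𝔹) (hsh : (⟨blockIter k b.src, b.dir⟩ : PBond P k) ∉ freeBonds S T) :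
    fderiv ℝ Xf 0 X b = 0 := by
  have h := eventually_apply_eq_zero_of_isMinimizer_expChart_family ch hk S T av reg 𝔹 W U₀ id Xf hX₀ hXc hmin
  exact fderiv_apply_eq_zero_of_eventually_apply_eq_zero Xf (h.mono fun Y hY => hY b hb hsh) X

end Support

/-! ## §5  At the endpoint's objects: the support letter of (K′) from the `hfar` clause -/

section AtRecord

variable {F : T4Family}

/-- ★★★ **THE SUPPORT LETTER OF THE REAL CHART FAMILY (K′) AT THE ENDPOINT'S OBJECTS.**  At one Prop-1 instance of `B15Prop1EndpointNearFlatLetters.…_ofNearFlatLetters[_sub]_oneSided`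
(averaging `Node00.avOfRecord F 2 Kt`, class `Node00.regMSCoPOfRecord F 2 ν Kt k (maxDomT ν.M₁ Z)`, determining set `𝐁_k(Z) = Bj ν.M₁ Z k`, slice `GaugeSlice (pts k Λ) T E3`, base field
`ext Ṽ_k`, `0 < k ≤ m + K`) and under the endpoint's `hfar` clause (a fine bond starting outside `Ω₁(Z) = maxDomT ν.M₁ Z 1` has its coarse shadow off the bonds of `Λ^{(k)}`):
the (K′) package's conclusions `X_f 0 = 0`, `X_f` continuous at `0` (e.g. from `ContDiffAt ℝ 2 X_f 0`) and the minimality letter `hmin` (VERBATIM the endpoint's `hNF` conjuncts)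
give (i) for all `Y` near `0`, `X_f Y (b) = 0` on every bond with `b₋ ∉ Ω₁(Z)`, and (ii) for every slice vector `X`, `(fderiv ℝ X_f 0 X) b = 0` on those bonds — the velocity
`w = X_f′(0)X` of the family is supported on the bonds starting in `Ω₁(Z)`.  The shape a localised (δ₁) letter consumes; nothing of Bałaban's is asserted.
[cite: Balaban1989LargeFieldI, (1.74) p.192, Prop. 1 p.194 (last clause); Balaban1989LargeFieldII, p.357, (1.12) p.359; Balaban1988Convergent, (2.2) p.255, (2.11)–(2.13) pp.256–257, (2.16) p.257; Balaban1985Variational, (15) p.280, Prop. 9 (190) p.309] -/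
theorem support_realChartFamily_atRecord (ν : Node00.Stage7Numerics) (Kt : ℕ) {k : ℕ} (hk0 : 0 < k) (hk : k ≤ (F.P Kt).m + (F.P Kt).K)
    (Z Λ : Set (Site (F.P Kt) 0)) (T : Finset (PBond (F.P Kt) k))
    (ext : GaugeField (F.P Kt) k SU2 → GaugeField (F.P Kt) k SU2) (Vk : GaugeField (F.P Kt) k SU2)
    (hfar : ∀ b : PBond (F.P Kt) 0, b.src ∉ maxDomT ν.M₁ Z 1 → (⟨blockIter k b.src, b.dir⟩ : PBond (F.P Kt) k) ∉ bondsOf (pts k Λ))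
    (U₀ : GaugeField (F.P Kt) 0 SU2) (Xf : GaugeSlice (pts k Λ) T E3 → PBond (F.P Kt) 0 → lieSU (Fin 2)) (hX₀ : Xf 0 = 0) (hXc : ContinuousAt Xf 0)
    (hmin : ∀ᶠ Y in 𝓝 (0 : GaugeSlice (pts k Λ) T E3),
      IsMinimizer (Node00.avOfRecord F 2 Kt) (Node00.regMSCoPOfRecord F 2 ν Kt k (maxDomT ν.M₁ Z)) (Bj ν.M₁ Z k)
        (avgFamily (Node00.avOfRecord F 2 Kt) (qsstarGIter0 k (expMul su2Chart (ιA (pts k Λ) T Y) (ext Vk)))) (expChart U₀ (Xf Y))) :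
    (∀ᶠ Y in 𝓝 (0 : GaugeSlice (pts k Λ) T E3), ∀ b : PBond (F.P Kt) 0, b.src ∉ maxDomT ν.M₁ Z 1 → Xf Y b = 0) ∧
      ∀ (X : GaugeSlice (pts k Λ) T E3) (b : PBond (F.P Kt) 0), b.src ∉ maxDomT ν.M₁ Z 1 → fderiv ℝ Xf 0 X b = 0 := by
  have hext : ∀ b : PBond (F.P Kt) 0, b.src ∉ maxDomT ν.M₁ Z 1 → b ∈ extBonds (Bj ν.M₁ Z k) := fun b hb => by
    show b ∈ bondsOf (Bj ν.M₁ Z k 0)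
    rw [Bj_zero hk0]
    exact Or.inl hb
  have hsh : ∀ b : PBond (F.P Kt) 0, b.src ∉ maxDomT ν.M₁ Z 1 → (⟨blockIter k b.src, b.dir⟩ : PBond (F.P Kt) k) ∉ freeBonds (pts k Λ) T :=
    fun b hb h => hfar b hb (mem_freeBonds.1 h).1
  have h := eventually_apply_eq_zero_of_isMinimizer_expChart_family su2Chart hk (pts k Λ) T (Node00.avOfRecord F 2 Kt)
    (Node00.regMSCoPOfRecord F 2 ν Kt k (maxDomT ν.M₁ Z)) (Bj ν.M₁ Z k) (ext Vk) U₀ id Xf hX₀ hXc hmin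
  refine ⟨h.mono fun Y hY b hb => hY b (hext b hb) (hsh b hb), fun X b hb => ?_⟩
  exact fderiv_apply_eq_zero_of_eventually_apply_eq_zero Xf (h.mono fun Y hY => hY b (hext b hb) (hsh b hb)) X

end AtRecord

end Literature.MathematicalPhysics.QuantumFieldTheory.Balaban1983to89.B15Prop1RealChartFamilySupport

end
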